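import Summits.Ventures.PercRepro.ProfilePointedCircuitClassesInOutTenA

/-!
# PercRepro — THE IN–OUT INEQUALITY AT `n = 10`, II: THE THREE RESOURCE UNITS OF A DEFICIENT DEMAND (p5, gen 40;
`proofs/P5-GM1.md` §59)

Continues part I.  For a deficient demand `W` (`κ(W) = 3`, `P` the 3-point series class of `E ∖ W`) some `w ∈ W − e`
has `(E ∖ W) − p + w` a basis (`p` is not a coloop of `N ∖ e`: `exists_rk_insert_erase_eq_six_of_deficient`), and by
the symmetry lemma `rk_insert_erase_eq_of_series` this holds for every `p ∈ P` at once.  For such a `w` and every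
pair `{p, p'} ⊆ P` the `5`-set `W' := ((E ∖ W) ∖ {p, p'}) + w` is a unit avoiding `e` with `W ∩ W' = {w}`,
`(E ∖ W') ∖ W = {p, p'}` and `ρ(E ∖ {p, p'}) = 5` (`unit_of_deficient`) — the three resources of `W`, paid in part III.
-/

open scoped Matroid

namespace PercRepro.Cogirth

open Finset ThmH Skew Shadow Profile

variable {α : Type} [DecidableEq α] {N : Matroid α} [N.Finite] {e : α}

section InOutTenB

/-- **The symmetry lemma**: if `{p, p'}` is a series pair (`ρ(E − {p, p'}) = 5`), `p'` is not a coloop, `B` is a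
basis through `p, p'`, `w ∉ B` and `B − p + w` is a basis, then `B − p' + w` is a basis too.  Otherwise
`Y := B − p − p' + w` (independent, rank `5`) has `p ∈ cl Y` (as `Y + p = B − p' + w` has rank `5`) and
`E − {p, p'} ⊆ cl Y` (same rank `5`), so `E − p' ⊆ cl Y` and `ρ(E − p') ≤ 5`. -/
theorem rk_insert_erase_eq_of_series {B : Finset α} (hB : B ⊆ gr N) (hB6 : B.card = 6) (hBrk : rk N B = 6)
    {p p' : α} (hpB : p ∈ B) (hp'B : p' ∈ B) (hpp' : p ≠ p') (hser : rk N (gr N \ {p, p'}) = 5) (hp'c : rk N ((gr N).erase p') = 6) {w : α}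
    (hw : w ∈ gr N) (hwB : w ∉ B) (hwp : rk N (insert w (B.erase p)) = 6) :
    rk N (insert w (B.erase p')) = 6 := by
  by_contra hne
  have hBp' : B.erase p' ⊆ gr N := (erase_subset _ _).trans hB
  have hBp'card : (B.erase p').card = 5 := by rw [card_erase_of_mem hp'B, hB6]
  have hBp'rk : rk N (B.erase p') = 5 := by
    have := rk_eq_card_of_subset_of_rk_eq_card (M := N) (erase_subset p' B) (hB6 ▸ hBrk)
    rwa [hBp'card] at this
  have h1 := rk_insert_le_add_one hw hBp'
  have h2 := rk_mono' (M := N) (subset_insert w (B.erase p'))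
  have h5 : rk N (insert w (B.erase p')) = 5 := by omega
  -- `Y := (B − p − p') + w`
  set Y := insert w ((B.erase p).erase p') with hYdef
  have hYsub : Y ⊆ insert w (B.erase p) := insert_subset_insert _ (erase_subset _ _)
  have hYg : Y ⊆ gr N := hYsub.trans (insert_subset hw ((erase_subset _ _).trans hB))
  have hwBp : w ∉ B.erase p := fun h => hwB (mem_of_mem_erase h)
  have hcardBp : (insert w (B.erase p)).card = 6 := by
    rw [card_insert_of_notMem hwBp, card_erase_of_mem hpB, hB6]
  have hYrk : rk N Y = 5 := by
    have := rk_eq_card_of_subset_of_rk_eq_card (M := N) hYsub (hcardBp ▸ hwp)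
    rw [this, hYdef, card_insert_of_notMem (fun h => hwB (mem_of_mem_erase (mem_of_mem_erase h))),
      card_erase_of_mem (mem_erase.2 ⟨hpp'.symm, hp'B⟩), card_erase_of_mem hpB, hB6]
  -- `Y + p = B − p' + w`
  have hYp : insert p Y = insert w (B.erase p') := by
    rw [hYdef, insert_comm, erase_right_comm, insert_erase (mem_erase.2 ⟨hpp', hpB⟩)]
  have hpY : p ∈ clF N Y := by
    rw [mem_clF_iff_rk_insert_eq (hB hpB) hYg, hYp, h5, hYrk]
  -- `E − {p, p'} ⊆ cl Y`
  have hYsub' : Y ⊆ gr N \ {p, p'} := by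
    intro g hg
    rw [hYdef, mem_insert, mem_erase, mem_erase] at hg
    rw [mem_sdiff, mem_insert, mem_singleton]
    rcases hg with h | ⟨h1, h2, h3⟩
    · subst h
      exact ⟨hw, fun h => h.elim (fun h => hwB (h ▸ hpB)) (fun h => hwB (h ▸ hp'B))⟩
    · exact ⟨hB h3, fun h => h.elim h2 h1⟩
  have hEcl : gr N \ {p, p'} ⊆ clF N Y := subset_clF_of_rk_le_rk hYsub' sdiff_subset (by rw [hser, hYrk])
  -- hence `E − p' ⊆ cl Y`
  have hEp' : (gr N).erase p' ⊆ clF N Y := by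
    intro g hg
    rw [mem_erase] at hg
    by_cases hgp : g = p
    · subst hgp; exact hpY
    · exact hEcl (mem_sdiff.2 ⟨hg.2, fun h => by
        rw [mem_insert, mem_singleton] at h
        exact h.elim hgp hg.1⟩)
  have h3 := rk_le_rk_of_subset_clF hEp'
  omega

/-- **The point `w`**: for a deficient demand `W` and `p ∈ P`, some `w ∈ W − e` has `(E ∖ W) − p + w` a basis;
otherwise every `w ∈ W − e` lies in `cl((E ∖ W) − p)`, so `E − e − p ⊆ cl((E ∖ W) − p)` has rank `≤ 5`, and
`p` would be a coloop of `N ∖ e`. -/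
theorem exists_rk_insert_erase_eq_six_of_deficient (hn : (gr N).card = 10)
    (hcf' : ∀ x ∈ (gr N).erase e, rk N (((gr N).erase e).erase x) = 6) {W : Finset α}
    (hW : W ∈ biIndepSets N 4) (heW : e ∈ W) {p : α} (hpB : p ∈ gr N \ W) :
    ∃ w ∈ W, w ≠ e ∧ rk N (insert w ((gr N \ W).erase p)) = 6 := by
  rw [mem_biIndepSets] at hW
  obtain ⟨hWg, hW4, hWrk, hWc⟩ := hW
  by_contra hcon
  simp only [not_exists, not_and] at hcon
  have hBcard : (gr N \ W).card = 6 := by rw [card_sdiff_of_subset hWg, hn, hW4]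
  have hBp : (gr N \ W).erase p ⊆ gr N := (erase_subset _ _).trans sdiff_subset
  have hBprk : rk N ((gr N \ W).erase p) = 5 := by
    have := rk_eq_card_of_subset_of_rk_eq_card (M := N) (erase_subset p (gr N \ W)) hWc
    rwa [card_erase_of_mem hpB, hBcard] at this
  have hpg : p ∈ gr N := (mem_sdiff.1 hpB).1
  have hpW : p ∉ W := (mem_sdiff.1 hpB).2
  have hpe : p ≠ e := fun h => hpW (h ▸ heW)
  -- `E − e − p ⊆ cl((E ∖ W) − p)`
  have hcl : ((gr N).erase e).erase p ⊆ clF N ((gr N \ W).erase p) := by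
    intro g hg
    rw [mem_erase, mem_erase] at hg
    obtain ⟨hgp, hge, hgE⟩ := hg
    by_cases hgW : g ∈ W
    · have h1 := hcon g hgW hge
      have h2 := rk_insert_le_add_one hgE hBp
      have h3 := rk_mono' (M := N) (subset_insert g ((gr N \ W).erase p))
      rw [mem_clF_iff_rk_insert_eq hgE hBp]
      omega
    · exact mem_clF_of_mem_of_subset_gr hBp (mem_erase.2 ⟨hgp, mem_sdiff.2 ⟨hgE, hgW⟩⟩)
  have h1 := rk_le_rk_of_subset_clF hcl
  have h2 := hcf' p (mem_erase.2 ⟨hpe, hpg⟩)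
  omega

/-- **The three resource units of a deficient demand.**  For `W ∈ BI_4`, `e ∈ W`, `κ(W) = 3` (so `P` has three
points), `p ≠ p'` in `P` and `w ∈ W − e` with `(E ∖ W) − p + w` a basis: the `5`-set `W' := ((E ∖ W) ∖ {p, p'}) + w`
is a unit avoiding `e`, `W ∩ W' = {w}`, `(E ∖ W') ∖ W = {p, p'}` and `ρ(E ∖ {p, p'}) = 5`. -/
theorem unit_of_deficient (hn : (gr N).card = 10)
    (hcf : ∀ x ∈ gr N, rk N ((gr N).erase x) = 6) {W : Finset α} (hW : W ∈ biIndepSets N 4) (heW : e ∈ W)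
    (hP : ((gr N \ W).filter (fun z => rk N (insert z W) = 5)).card = 3) {p p' : α}
    (hp : p ∈ (gr N \ W).filter (fun z => rk N (insert z W) = 5))
    (hp' : p' ∈ (gr N \ W).filter (fun z => rk N (insert z W) = 5)) (hpp' : p ≠ p') {w : α} (hwW : w ∈ W)
    (hwe : w ≠ e) (hwp : rk N (insert w ((gr N \ W).erase p)) = 6) :
    insert w ((gr N \ W) \ {p, p'}) ∈ (biIndepSets N 5).filter (fun W' => e ∉ W') ∧
      W ∩ insert w ((gr N \ W) \ {p, p'}) = {w} ∧
      (gr N \ insert w ((gr N \ W) \ {p, p'})) \ W = {p, p'} ∧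
      rk N (gr N \ {p, p'}) = 5 := by
  have hser := rk_sdiff_pair_eq_five_of_deficient hcf hW hP hp hp' hpp'
  have hsix := rk_insert_insert_eq_six_of_deficient hcf hW hP hp hp' hpp'
  rw [mem_biIndepSets] at hW
  obtain ⟨hWg, hW4, hWrk, hWc⟩ := hW
  have hBcard : (gr N \ W).card = 6 := by rw [card_sdiff_of_subset hWg, hn, hW4]
  have hpB : p ∈ gr N \ W := (mem_filter.1 hp).1
  have hp'B : p' ∈ gr N \ W := (mem_filter.1 hp').1
  have hpg : p ∈ gr N := (mem_sdiff.1 hpB).1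
  have hp'g : p' ∈ gr N := (mem_sdiff.1 hp'B).1
  have hpW : p ∉ W := (mem_sdiff.1 hpB).2
  have hp'W : p' ∉ W := (mem_sdiff.1 hp'B).2
  have hwg : w ∈ gr N := hWg hwW
  have hwB : w ∉ gr N \ W := fun h => (mem_sdiff.1 h).2 hwW
  have hpair : ({p, p'} : Finset α) ⊆ gr N \ W := by
    intro g hg
    rw [mem_insert, mem_singleton] at hg
    rcases hg with h | h <;> subst h <;> assumption
  set W' := insert w ((gr N \ W) \ {p, p'}) with hW'def
  have hwB' : w ∉ (gr N \ W) \ {p, p'} := fun h => hwB (mem_sdiff.1 h).1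
  have hW'card : W'.card = 5 := by
    rw [hW'def, card_insert_of_notMem hwB', card_sdiff_of_subset hpair, hBcard, card_pair hpp']
  have hW'g : W' ⊆ gr N := insert_subset hwg (sdiff_subset.trans sdiff_subset)
  -- `W' ⊆ (E ∖ W) − p + w`, a basis
  have hW'sub : W' ⊆ insert w ((gr N \ W).erase p) := by
    apply insert_subset_insert
    intro g hg
    rw [mem_sdiff, mem_insert, mem_singleton] at hg
    exact mem_erase.2 ⟨fun h => hg.2 (Or.inl h), hg.1⟩
  have hbasis : rk N (insert w ((gr N \ W).erase p)) = (insert w ((gr N \ W).erase p)).card := by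
    rw [hwp, card_insert_of_notMem (fun h => hwB (mem_of_mem_erase h)), card_erase_of_mem hpB, hBcard]
  have hW'rk : rk N W' = 5 := by
    rw [← hW'card]
    exact rk_eq_card_of_subset_of_rk_eq_card hW'sub hbasis
  -- the complement `E ∖ W' = (W − w) ∪ {p, p'}`
  have hcompl : gr N \ W' = (W.erase w) ∪ {p, p'} := by
    ext g
    rw [hW'def, mem_sdiff, mem_insert, mem_sdiff, mem_sdiff, mem_union, mem_erase, mem_insert, mem_singleton]
    constructor
    · rintro ⟨hg, h⟩
      by_cases hgpp : g = p ∨ g = p'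
      · exact Or.inr hgpp
      · by_cases hgW : g ∈ W
        · refine Or.inl ⟨fun hgw => h (Or.inl hgw), hgW⟩
        · exact absurd (Or.inr ⟨⟨hg, hgW⟩, hgpp⟩) h
    · rintro (⟨hgw, hgW⟩ | hgpp)
      · exact ⟨hWg hgW, fun h => h.elim hgw (fun h' => h'.1.2 hgW)⟩
      · refine ⟨?_, fun h => h.elim (fun h' => ?_) (fun h' => h'.2 hgpp)⟩
        · rcases hgpp with h | h <;> subst h <;> assumption
        · rcases hgpp with h | h <;> subst h
          · exact hpW (h' ▸ hwW)
          · exact hp'W (h' ▸ hwW)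
  have hcomplcard : (gr N \ W').card = 5 := by rw [card_sdiff_of_subset hW'g, hn, hW'card]
  -- `(W − w) ∪ {p, p'} = (W ∪ {p, p'}) − w` has rank `≥ 6 − 1`
  have hcomplrk : rk N (gr N \ W') = 5 := by
    have hX : insert p' (insert p W) ⊆ gr N := insert_subset hp'g (insert_subset hpg hWg)
    have hwX : w ∈ insert p' (insert p W) := mem_insert_of_mem (mem_insert_of_mem hwW)
    have hXe : (insert p' (insert p W)).erase w = gr N \ W' := by
      rw [hcompl]
      ext g
      rw [mem_erase, mem_insert, mem_insert, mem_union, mem_erase, mem_insert, mem_singleton]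
      constructor
      · rintro ⟨hgw, h | h | h⟩
        · exact Or.inr (Or.inr h)
        · exact Or.inr (Or.inl h)
        · exact Or.inl ⟨hgw, h⟩
      · rintro (⟨hgw, hgW⟩ | h | h)
        · exact ⟨hgw, Or.inr (Or.inr hgW)⟩
        · subst h; exact ⟨fun h => hpW (h ▸ hwW), Or.inr (Or.inl rfl)⟩
        · subst h; exact ⟨fun h => hp'W (h ▸ hwW), Or.inl rfl⟩
    have h1 := rk_le_rk_erase_add_one (M := N) hX hwX
    rw [hXe, hsix] at h1
    have h2 := rk_le_card (M := N) (gr N \ W')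
    rw [hcomplcard] at h2
    omega
  refine ⟨?_, ?_, ?_, hser⟩
  · rw [mem_filter, mem_biIndepSets]
    refine ⟨⟨hW'g, hW'card, by rw [hW'rk, hW'card], by rw [hcomplrk, hcomplcard]⟩, ?_⟩
    rw [hW'def, mem_insert, mem_sdiff, mem_sdiff]
    rintro (h | ⟨⟨_, h⟩, _⟩)
    · exact hwe h.symm
    · exact h heW
  · ext g
    rw [hW'def, mem_inter, mem_insert, mem_sdiff, mem_sdiff, mem_singleton]
    constructor
    · rintro ⟨hgW, h | ⟨⟨_, h⟩, _⟩⟩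
      · exact h
      · exact absurd hgW h
    · rintro rfl
      exact ⟨hwW, Or.inl rfl⟩
  · rw [hcompl]
    ext g
    rw [mem_sdiff, mem_union, mem_erase, mem_insert, mem_singleton]
    constructor
    · rintro ⟨h | h, hgW⟩
      · exact absurd h.2 hgW
      · exact h
    · intro h
      refine ⟨Or.inr h, ?_⟩
      rcases h with h | h <;> subst h <;> assumption

end InOutTenB

end PercRepro.Cogirth
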